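import Summits.Ventures.PercRepro.C041ZoneOCubeCountDefs

/-!
# The ZONE O-CUBE for ONE ANCHOR — the COUNT FORM (mine-3's C-041.md §15 (a)) in the kernel (p6, gen 28)

Setting of `C041ZoneOCubeCountDefs` (plain case `Q = ∅`, a single anchor `k`, its sub-zone `C = P {k} σ`, the
three kinds `F` / `T₁` / `T₂` of admissible states, the invalid ones `I`).

THE TWO INVOLUTIONS. `phi0 σ := flipOut (D σ) σ` (STEP 1 of §12 (d) with nothing protected) preserves `D`, `adm`
and the marks; for a non-deleted anchor it carries `REACH {k}` — the red reach of `k` among the non-deleted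
vertices — onto the blue sub-zone of `k` in the image (`P_phi0_eq_REACH`), so `G1` («a red `2`-edge at `REACH`»)
becomes «a red `2`-edge on the anchor's sub-zone» (`G1_iff_phi0`).  `swap2 σ` exchanges the two constant
`2`-patterns (all-red ↔ all-blue) at the vertices of the anchor's sub-zone and fixes every mixed pattern
(`swapMark` of `C041ZoneZMarks` on the complement of `C`); it preserves `C`, `D`, the `1`-marks and `adm` (the
sub-zone of a non-deleted anchor misses `D`), and exchanges «a red `2`-edge on `C`» with «a blue `2`-edge on `C`»,
i.e. with `k ∈ D2`.  Hence `#{adm ∧ G1} = #T₂` (`card_G1set_eq_card_T2set`).  The MIRROR `#{adm ∧ G2} = #T₁`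
(`card_G2set_eq_card_T1set`) is the same theorem on the zone with the two kinds of terminal edges exchanged
(`flipTerm`, `flipState`: `D ↔ D2`, `REACH ↔ REACH2`, `G1 ↔ G2`, `adm ↔ adm` by `adm_iff_disjoint_Bl_D2`).

* **`zoneOCube_single_eq`** — THE COUNT FORM: `zoneOCube {k} ∅ = #T₁ + #T₂ + 2·#I − 2·#F`;
* **`zoneOCubeConj_single_iff`** / **`zoneOCubeConj_single_iff'`** — the ONE-ANCHOR ZONE O-CUBE ⟺
  `2·#F ≤ #T₁ + #T₂ + 2·#I` ⟺ `3·#F ≤ #adm + 2·#I` («at least two thirds of the valid states have the anchor's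
  sub-zone attached to a terminal»): a pure count, (INV)-shaped, no weights and no `REACH`.

NOT claimed: the count inequality itself (mine-3's census C-041.md §15: 0 violations; per layer it is NOT local).
-/

namespace PercRepro

namespace ZoneZ

namespace ZoneData

open Finset

variable {V E T₁ T₂ : Type*} (Z : ZoneData V E T₁ T₂) (k : V)

/-! ## The first involution: the complement outside the deleted vertices -/

/-- STEP 1 with nothing protected: the complement outside the deleted vertices. -/
noncomputable def phi0 (σ : State E T₁ T₂) : State E T₁ T₂ := Z.flipOut (Z.D σ) σ

/-- `phi0` preserves `D`. -/
theorem D_phi0 (σ : State E T₁ T₂) : Z.D (Z.phi0 σ) = Z.D σ := Z.D_flipOut_eq _ σ le_rfl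

/-- `phi0` preserves the `2`-marks. -/
theorem M_phi0 (σ : State E T₁ T₂) : Z.M (Z.phi0 σ) = Z.M σ := rfl

/-- `phi0` preserves the `2`-marks. -/
theorem Mt_phi0 (σ : State E T₁ T₂) : Z.Mt (Z.phi0 σ) = Z.Mt σ := rfl

/-- `phi0` is an involution. -/
theorem phi0_phi0 (σ : State E T₁ T₂) : Z.phi0 (Z.phi0 σ) = σ := by
  have h := Z.D_phi0 σ
  unfold phi0 at h ⊢
  rw [h, Z.flipOut_flipOut]

/-- `phi0` preserves admissibility. -/
theorem adm_phi0 (σ : State E T₁ T₂) : Z.adm (Z.phi0 σ) ↔ Z.adm σ := by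
  unfold adm
  rw [Z.M_phi0, Z.D_phi0]

/-- For a non-deleted anchor the blue sub-zone of the anchor in `phi0 σ` is `REACH {k} σ`: the red reach of the
anchor among the non-deleted vertices (a blue edge of the image leaving the non-deleted vertices would be an
unchanged blue edge of `σ` entering `D`). -/
theorem P_phi0_eq_REACH (σ : State E T₁ T₂) (hk : k ∉ Z.D σ) : Z.P {k} (Z.phi0 σ) = Z.REACH {k} σ := by
  unfold phi0 P REACH reachIn
  apply Set.Subset.antisymm
  · apply reach_subset_of_closed
    · intro v hv
      rw [Set.mem_singleton_iff] at hv
      subst hv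
      exact mem_reach_of_mem ⟨Set.mem_singleton v, hk⟩
    · intro u v hu h
      have huD : u ∉ Z.D σ := reach_subset_of_closed Set.inter_subset_right (fun _ _ _ h => h.2.2) hu
      have hvD : v ∉ Z.D σ := by
        intro hvD
        obtain ⟨e, hj, hc⟩ := h
        have ht : Z.Touches (Z.D σ) e := Z.touches_of_joins_left hj.symm hvD
        rw [Z.flipOut_fst_of_touches _ σ ht] at hc
        exact huD (Z.blue_closed_D σ v u hvD ⟨e, hj.symm, hc⟩)
      exact reach_tail hu ⟨(Z.blueAdj_flipOut_iff _ σ huD hvD).1 h, huD, hvD⟩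
  · apply reach_mono
    · rintro u v ⟨h, hu, hv⟩
      exact (Z.blueAdj_flipOut_iff _ σ hu hv).2 h
    · exact Set.inter_subset_left

/-- For a non-deleted anchor, `G1` in `σ` is «a red `2`-edge on the anchor's sub-zone» in `phi0 σ`. -/
theorem G1_iff_phi0 (σ : State E T₁ T₂) (hk : k ∉ Z.D σ) :
    Z.G1 {k} σ ↔ (Z.P {k} (Z.phi0 σ) ∩ Z.Mt (Z.phi0 σ)).Nonempty := by
  unfold G1
  rw [Z.P_phi0_eq_REACH k σ hk, Z.Mt_phi0]

/-! ## The second involution: the `2`-pattern swap on the anchor's sub-zone -/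

/-- Exchange the two constant `2`-patterns (all-red ↔ all-blue) at every vertex of the anchor's sub-zone; every
mixed pattern and every vertex outside the sub-zone is left alone. -/
noncomputable def swap2 (σ : State E T₁ T₂) : State E T₁ T₂ :=
  (σ.1, σ.2.1, swapMark Z.at₂ (Z.P {k} σ)ᶜ σ.2.2)

/-- `swap2` does not change the edges, hence not the anchor's sub-zone. -/
theorem P_swap2 (σ : State E T₁ T₂) : Z.P {k} (Z.swap2 k σ) = Z.P {k} σ := rfl

/-- `swap2` does not change the edges or the `1`-marks, hence not `D`. -/
theorem D_swap2 (σ : State E T₁ T₂) : Z.D (Z.swap2 k σ) = Z.D σ := rfl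

/-- `swap2` is an involution. -/
theorem swap2_swap2 (σ : State E T₁ T₂) : Z.swap2 k (Z.swap2 k σ) = σ := by
  have h : Z.P {k} (Z.swap2 k σ) = Z.P {k} σ := rfl
  show (σ.1, σ.2.1, swapMark Z.at₂ (Z.P {k} (Z.swap2 k σ))ᶜ (swapMark Z.at₂ (Z.P {k} σ)ᶜ σ.2.2)) = σ
  rw [h, swapMark_swapMark]

/-- On the anchor's sub-zone the blue `2`-marks of `swap2 σ` are the red `2`-marks of `σ`. -/
theorem mem_M_swap2_of_mem (σ : State E T₁ T₂) {v : V} (hv : v ∈ Z.P {k} σ) :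
    v ∈ Z.M (Z.swap2 k σ) ↔ v ∈ Z.Mt σ :=
  mem_markSet_swapMark_of_not_mem Z.at₂ (Z.P {k} σ)ᶜ σ.2.2 false fun h => h hv

/-- On the anchor's sub-zone the red `2`-marks of `swap2 σ` are the blue `2`-marks of `σ`. -/
theorem mem_Mt_swap2_of_mem (σ : State E T₁ T₂) {v : V} (hv : v ∈ Z.P {k} σ) :
    v ∈ Z.Mt (Z.swap2 k σ) ↔ v ∈ Z.M σ :=
  mem_markSet_swapMark_of_not_mem Z.at₂ (Z.P {k} σ)ᶜ σ.2.2 true fun h => h hv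

/-- Outside the anchor's sub-zone the blue `2`-marks are unchanged. -/
theorem mem_M_swap2_of_not_mem (σ : State E T₁ T₂) {v : V} (hv : v ∉ Z.P {k} σ) :
    v ∈ Z.M (Z.swap2 k σ) ↔ v ∈ Z.M σ :=
  mem_markSet_swapMark_of_mem Z.at₂ (Z.P {k} σ)ᶜ σ.2.2 false hv

/-- For a non-deleted anchor `swap2` preserves admissibility (its sub-zone misses `D`, where the `2`-marks are
unchanged). -/
theorem adm_swap2 (σ : State E T₁ T₂) (hk : k ∉ Z.D σ) : Z.adm (Z.swap2 k σ) ↔ Z.adm σ := by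
  unfold adm
  rw [Z.D_swap2]
  have hPD := Z.disjoint_P_D_of_not_mem k σ hk
  constructor
  · intro h
    rw [Set.disjoint_left] at h ⊢
    intro v hvM hvD
    have hvP : v ∉ Z.P {k} σ := fun hvP => Set.disjoint_left.1 hPD hvP hvD
    exact h ((Z.mem_M_swap2_of_not_mem k σ hvP).2 hvM) hvD
  · intro h
    rw [Set.disjoint_left] at h ⊢
    intro v hvM hvD
    have hvP : v ∉ Z.P {k} σ := fun hvP => Set.disjoint_left.1 hPD hvP hvD
    exact h ((Z.mem_M_swap2_of_not_mem k σ hvP).1 hvM) hvD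

/-- `swap2` exchanges «a red `2`-edge on the anchor's sub-zone» with «a blue `2`-edge on it». -/
theorem inter_Mt_nonempty_iff_swap2 (σ : State E T₁ T₂) :
    (Z.P {k} σ ∩ Z.Mt σ).Nonempty ↔ (Z.P {k} (Z.swap2 k σ) ∩ Z.M (Z.swap2 k σ)).Nonempty := by
  rw [Z.P_swap2]
  constructor
  · rintro ⟨v, hvP, hvM⟩
    exact ⟨v, hvP, (Z.mem_M_swap2_of_mem k σ hvP).2 hvM⟩
  · rintro ⟨v, hvP, hvM⟩
    exact ⟨v, hvP, (Z.mem_M_swap2_of_mem k σ hvP).1 hvM⟩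

/-- `swap2` exchanges «a blue `2`-edge on the anchor's sub-zone» with «a red `2`-edge on it». -/
theorem inter_M_nonempty_iff_swap2 (σ : State E T₁ T₂) :
    (Z.P {k} σ ∩ Z.M σ).Nonempty ↔ (Z.P {k} (Z.swap2 k σ) ∩ Z.Mt (Z.swap2 k σ)).Nonempty := by
  rw [Z.P_swap2]
  constructor
  · rintro ⟨v, hvP, hvM⟩
    exact ⟨v, hvP, (Z.mem_Mt_swap2_of_mem k σ hvP).2 hvM⟩
  · rintro ⟨v, hvP, hvM⟩
    exact ⟨v, hvP, (Z.mem_Mt_swap2_of_mem k σ hvP).1 hvM⟩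

section Counts

variable [Fintype E] [DecidableEq E] [Fintype T₁] [DecidableEq T₁] [Fintype T₂] [DecidableEq T₂]

/-- `phi0` exchanges `G1set` and `Xset`: `#{adm ∧ G1} = #X`. -/
theorem card_G1set_eq_card_Xset : #(Z.G1set k) = #(Z.Xset k) := by
  refine card_eq_of_involutive (Z.phi0) (Z.phi0_phi0) ?_ ?_
  · intro σ hσ
    rw [Z.mem_G1set] at hσ
    rw [Z.mem_Xset]
    have hk : k ∉ Z.D σ := Z.not_mem_D_of_G1 k σ hσ.2
    refine ⟨(Z.adm_phi0 σ).2 hσ.1, ?_, (Z.G1_iff_phi0 k σ hk).1 hσ.2⟩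
    rw [Z.D_phi0]
    exact hk
  · intro σ hσ
    rw [Z.mem_Xset] at hσ
    rw [Z.mem_G1set]
    refine ⟨(Z.adm_phi0 σ).2 hσ.1, ?_⟩
    have hk : k ∉ Z.D (Z.phi0 σ) := by
      rw [Z.D_phi0]
      exact hσ.2.1
    rw [Z.G1_iff_phi0 k _ hk, Z.phi0_phi0]
    exact hσ.2.2

/-- `swap2` exchanges `Xset` and `T₂`: `#X = #T₂`. -/
theorem card_Xset_eq_card_T2set : #(Z.Xset k) = #(Z.T2set k) := by
  refine card_eq_of_involutive (Z.swap2 k) (Z.swap2_swap2 k) ?_ ?_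
  · intro σ hσ
    rw [Z.mem_Xset] at hσ
    rw [Z.mem_T2set, Z.mem_D2_iff_inter]
    exact ⟨(Z.adm_swap2 k σ hσ.2.1).2 hσ.1, (Z.inter_Mt_nonempty_iff_swap2 k σ).1 hσ.2.2⟩
  · intro σ hσ
    rw [Z.mem_T2set, Z.mem_D2_iff_inter] at hσ
    rw [Z.mem_Xset, Z.D_swap2]
    have hk : k ∉ Z.D σ := Z.not_mem_D_of_mem_D2 k σ hσ.1 ((Z.mem_D2_iff_inter k σ).2 hσ.2)
    exact ⟨(Z.adm_swap2 k σ hk).2 hσ.1, hk, (Z.inter_M_nonempty_iff_swap2 k σ).1 hσ.2⟩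

/-- **`#{adm ∧ G1} = #T₂`** (mine-3's §15 (a), side `1`). -/
theorem card_G1set_eq_card_T2set : #(Z.G1set k) = #(Z.T2set k) :=
  (Z.card_G1set_eq_card_Xset k).trans (Z.card_Xset_eq_card_T2set k)

end Counts

/-! ## The mirror: the zone with the two kinds of terminal edges exchanged -/

/-- The zone with the `1`-edges and the `2`-edges exchanged. -/
def flipTerm : ZoneData V E T₂ T₁ := ⟨Z.fst, Z.snd, Z.at₂, Z.at₁⟩

/-- The state with the two colourings of terminal edges exchanged. -/
def flipState (σ : State E T₁ T₂) : State E T₂ T₁ := (σ.1, σ.2.2, σ.2.1)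

/-- Exchanging twice is the identity. -/
theorem flipState_flipState (σ : State E T₁ T₂) : flipState (flipState σ) = σ := rfl

/-- The exchange as an equivalence of state types. -/
def flipEquiv : State E T₁ T₂ ≃ State E T₂ T₁ where
  toFun := flipState
  invFun := flipState
  left_inv := flipState_flipState
  right_inv := flipState_flipState

/-- The mirror's `D` is `D2`. -/
theorem D_flipTerm (σ : State E T₁ T₂) : Z.flipTerm.D (flipState σ) = Z.D2 σ := rfl

/-- The mirror's `D2` is `D`. -/
theorem D2_flipTerm (σ : State E T₁ T₂) : Z.flipTerm.D2 (flipState σ) = Z.D σ := rfl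

/-- The mirror's `G1` is `G2`. -/
theorem G1_flipTerm (A : Set V) (σ : State E T₁ T₂) : Z.flipTerm.G1 A (flipState σ) ↔ Z.G2 A σ := Iff.rfl

/-- The mirror's admissibility is admissibility. -/
theorem adm_flipTerm (σ : State E T₁ T₂) : Z.flipTerm.adm (flipState σ) ↔ Z.adm σ := by
  rw [Z.adm_iff_disjoint_Bl_D2]
  exact Iff.rfl

section Mirror

variable [Fintype E] [DecidableEq E] [Fintype T₁] [DecidableEq T₁] [Fintype T₂] [DecidableEq T₂]

/-- `#{adm ∧ G2}` is the mirror's `#{adm ∧ G1}`. -/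
theorem card_G2set_eq_flipTerm : #(Z.G2set k) = #(Z.flipTerm.G1set k) := by
  refine Finset.card_equiv flipEquiv fun σ => ?_
  rw [Z.mem_G2set, Z.flipTerm.mem_G1set]
  show Z.adm σ ∧ Z.G2 {k} σ ↔ Z.flipTerm.adm (flipState σ) ∧ Z.flipTerm.G1 {k} (flipState σ)
  rw [Z.adm_flipTerm, Z.G1_flipTerm]

/-- `#T₁` is the mirror's `#T₂`. -/
theorem card_T1set_eq_flipTerm : #(Z.T1set k) = #(Z.flipTerm.T2set k) := by
  refine Finset.card_equiv flipEquiv fun σ => ?_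
  rw [Z.mem_T1set, Z.flipTerm.mem_T2set]
  show Z.adm σ ∧ k ∈ Z.D σ ↔ Z.flipTerm.adm (flipState σ) ∧ k ∈ Z.flipTerm.D2 (flipState σ)
  rw [Z.adm_flipTerm, Z.D2_flipTerm]

/-- **`#{adm ∧ G2} = #T₁`** (mine-3's §15 (a), side `2`). -/
theorem card_G2set_eq_card_T1set : #(Z.G2set k) = #(Z.T1set k) := by
  rw [Z.card_G2set_eq_flipTerm, Z.card_T1set_eq_flipTerm]
  exact Z.flipTerm.card_G1set_eq_card_T2set k

end Mirror

/-! ## The count form -/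

section CountForm

variable [Fintype E] [DecidableEq E] [Fintype T₁] [DecidableEq T₁] [Fintype T₂] [DecidableEq T₂]

open Classical in
/-- The ZONE O-CUBE sum of one anchor through the counts `#{adm ∧ G1}`, `#{adm ∧ G2}`, `#{adm ∧ valid}`. -/
theorem zoneOCube_single_eq_counts :
    Z.zoneOCube {k} (∅ : Set V) = 3 * (#(Z.G1set k) : ℤ) + 3 * #(Z.G2set k) - 2 * #(Z.Vset k) := by
  unfold zoneOCube
  rw [Finset.sum_congr rfl fun σ _ => Z.ocWeight_eq {k} σ, Finset.sum_sub_distrib, Finset.sum_add_distrib,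
    ← Finset.mul_sum, ← Finset.mul_sum, ← Finset.mul_sum, Finset.sum_boole, Finset.sum_boole, Finset.sum_boole]
  have e1 : (Z.Aset (∅ : Set V)).filter (fun σ => Z.G1 {k} σ) = Z.G1set k := by
    ext σ
    rw [Finset.mem_filter, Z.mem_Aset_empty, Z.mem_G1set]
  have e2 : (Z.Aset (∅ : Set V)).filter (fun σ => Z.G2 {k} σ) = Z.G2set k := by
    ext σ
    rw [Finset.mem_filter, Z.mem_Aset_empty, Z.mem_G2set]
  have e3 : (Z.Aset (∅ : Set V)).filter (fun σ => Z.Valid {k} σ) = Z.Vset k := by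
    ext σ
    rw [Finset.mem_filter, Z.mem_Aset_empty, Z.mem_Vset]
  rw [e1, e2, e3]

/-- **THE COUNT FORM OF THE ONE-ANCHOR ZONE O-CUBE** (mine-3's C-041.md §15 (a)):
`Σ_{adm} [valid]·(3·G1 + 3·G2 − 2) = #T₁ + #T₂ + 2·#I − 2·#F`. -/
theorem zoneOCube_single_eq :
    Z.zoneOCube {k} (∅ : Set V) = (#(Z.T1set k) : ℤ) + #(Z.T2set k) + 2 * #(Z.Iset k) - 2 * #(Z.Fset k) := by
  rw [Z.zoneOCube_single_eq_counts, Z.card_G1set_eq_card_T2set, Z.card_G2set_eq_card_T1set]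
  have h1 := Z.card_Aset_eq_count k
  have h2 := Z.card_Vset_add_card_Iset k
  omega

/-- **The ONE-ANCHOR ZONE O-CUBE is a pure count**: `2·#F ≤ #T₁ + #T₂ + 2·#I`. -/
theorem zoneOCubeConj_single_iff :
    Z.ZoneOCubeConj {k} (∅ : Set V) ↔ 2 * #(Z.Fset k) ≤ #(Z.T1set k) + #(Z.T2set k) + 2 * #(Z.Iset k) := by
  unfold ZoneOCubeConj
  rw [Z.zoneOCube_single_eq]
  omega

/-- **The ONE-ANCHOR ZONE O-CUBE ⟺ `3·#F ≤ #adm + 2·#I`**: at least two thirds of the valid states have the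
anchor's sub-zone attached to a terminal. -/
theorem zoneOCubeConj_single_iff' :
    Z.ZoneOCubeConj {k} (∅ : Set V) ↔ 3 * #(Z.Fset k) ≤ #(Z.Aset (∅ : Set V)) + 2 * #(Z.Iset k) := by
  rw [Z.zoneOCubeConj_single_iff, Z.card_Aset_eq_count k]
  omega

end CountForm


end ZoneData

end ZoneZ

end PercRepro
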